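import Mathlib
import Summits.Langlands.Langlands.Theorems.PicardMuOrdinaryResidualAutomorphyEvenTeichmuller

/-!
# The Teichmüller twist of an algebraic Hecke character (assembly)

Helper file for item stmt-Langlands-13760 (route `PicardMuOrdinary`, decl `ResidualAutomorphyEven`);
sequel to the `Teichmuller` file (Teichmüller lift `μ_N(ℂ) ≅ (ℤ̄/𝔐)ˣ[N]`, congruences of embeddings)
and the `Integrality` file (`Ψ(𝔞) = N𝔞 · χ̃(𝔞)` on the ray).  For `χ` of infinity type `(p, q)` with
`1 + p_w, 1 + q_w ≥ 0` on a totally complex field `L`, a module of definition `(T, e)` with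
`𝔪(T, e) ⊆ (ℓ)` and a maximal ideal `𝔐 ∋ ℓ` of `ℤ̄`:

* `isIntegral_Psi`, `mk_zlift_Psi_pow_eq_one` — `Ψ(𝔞)` is an algebraic integer and a root of unity
  of order `N₀` prime to `ℓ` modulo `𝔐`, for `𝔞` prime to `𝔪` (`exists_torsion_exponent`);
* `mk_zlift_Psi_span_eq` — `Ψ((b)) ≡ Ψ((c)) (mod 𝔐)` on the ray modulo `𝔪`;
* `exists_teichmuller_twist` — **there is a Hecke character `χ₀` of finite order, unramified off `T`,
  with `N v · χ(ϖ_v) · χ₀(ϖ_v) ∈ ℤ̄` and `≡ 1 (mod 𝔐)` for every `v ∉ T`** (`χ₀` = the Hecke character of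
  the ray class character `𝔞 ↦ τ(Ψ(𝔞) mod 𝔐)⁻¹`, `τ` the Teichmüller lift; tree:
  `HeckeCharacter.exists_of_isRayClassCharacter`);
* `exists_isModulus_le_span` — every Hecke character has a module of definition with `𝔪 ⊆ (ℓ)`.
-/

set_option linter.dupNamespace false -- project-wide option (lakefile weak.linter.dupNamespace); `Summit.Langlands.Langlands` is the mandated namespace

noncomputable section

namespace Summit.Langlands.Langlands.Theorems.ResidualAutomorphyEven

open NumberField NumberField.InfinitePlace IsDedekindDomain Filter
open Literature.NumberTheory.GaloisRepresentations Literature.NumberTheory.LFunctions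
open scoped ComplexConjugate Classical

/-! ### `Ψ` through the prime values `N v · χ(ϖ_v)`; integrality and torsion modulo `𝔐` -/

section Reduction

variable {L : Type*} [Field L] [NumberField L] {χ : HeckeCharacter L} {p q : InfinitePlace L → ℤ}
  {T : Finset (HeightOneSpectrum (𝓞 L))} {e : HeightOneSpectrum (𝓞 L) → ℕ}

/-- A prime ideal coprime to `𝔪(T, e)` is `𝔭_v` for some `v ∉ T`. -/
theorem not_mem_of_isCoprime {v : HeightOneSpectrum (𝓞 L)} (h : IsCoprime v.asIdeal (HeckeCharacter.modulusIdeal T e)) :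
    v ∉ T := by
  intro hv
  have hle : HeckeCharacter.modulusIdeal T e ≤ v.asIdeal := HeckeCharacter.modulusIdeal_le_iff.mpr hv
  rw [Ideal.isCoprime_iff_sup_eq, sup_eq_left.mpr hle] at h
  exact v.isPrime.ne_top h

/-- **Induction over the nonzero ideals prime to `𝔪`** along `𝔞 = 𝔭 · 𝔞'` (unique factorisation). -/
theorem induction_on_coprime {P : Ideal (𝓞 L) → Prop} (𝔪 : Ideal (𝓞 L)) (htop : P ⊤)
    (hstep : ∀ (v : HeightOneSpectrum (𝓞 L)) (𝔞 : Ideal (𝓞 L)), 𝔞 ≠ ⊥ → IsCoprime v.asIdeal 𝔪 → IsCoprime 𝔞 𝔪 →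
      P 𝔞 → P (v.asIdeal * 𝔞))
    {𝔞 : Ideal (𝓞 L)} (h𝔞 : 𝔞 ≠ ⊥) (hcop : IsCoprime 𝔞 𝔪) : P 𝔞 := by
  have key : ∀ I : Ideal (𝓞 L), I ≠ ⊥ → IsCoprime I 𝔪 → P I := by
    intro I
    refine UniqueFactorizationMonoid.induction_on_prime I (fun h => absurd rfl h) (fun I hI _ _ => ?_) ?_
    · rw [Ideal.isUnit_iff.mp hI]; exact htop
    · intro a p ha hp ih _ hcop'
      have hp0 : p ≠ ⊥ := hp.ne_zero
      have hpP : p.IsPrime := (Ideal.prime_iff_isPrime hp0).mp hp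
      set v : HeightOneSpectrum (𝓞 L) := ⟨p, hpP, hp0⟩
      have hcp : IsCoprime p 𝔪 := IsCoprime.of_mul_left_left hcop'
      have hca : IsCoprime a 𝔪 := IsCoprime.of_mul_left_right hcop'
      exact hstep v a ha hcp hca (ih ha hca)
  exact key 𝔞 h𝔞 hcop

/-- **`Ψ(𝔞) = ∏_𝔭 (N𝔭 · χ(ϖ_𝔭))^{v_𝔭(𝔞)}`**: `Ψ` is the ideal character of the prime values `N v · χ(ϖ_v)`. -/
theorem idealPow_residueCard_mul_eq_Psi {𝔞 : Ideal (𝓞 L)} (h𝔞 : 𝔞 ≠ ⊥) :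
    idealPow L (fun v => (v.residueCard : ℂ) * χ.valueAtUniformizer v) 𝔞 = Psi χ 𝔞 := by
  refine induction_on_coprime (P := fun I => idealPow L (fun v => (v.residueCard : ℂ) * χ.valueAtUniformizer v) I = Psi χ I)
    1 ?_ (fun v I hI _ _ ih => ?_) h𝔞 isCoprime_one_right
  · simp only [idealPow_top, Psi, Ideal.absNorm_top, Nat.cast_one, one_mul]
  · rw [idealPow_mul _ v.ne_bot hI, Psi_mul χ v.ne_bot hI, idealPow_asIdeal, Psi_asIdeal, ih]

variable [IsTotallyComplex L]

/-- **`Ψ(𝔞)` is an algebraic integer** for `𝔞` prime to `𝔪` (infinity type with `1 + p, 1 + q ≥ 0`). -/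
theorem isIntegral_Psi (hinf : χ.HasInfinityType p q) (hmod : HeckeCharacter.IsModulus χ T e)
    (hp : ∀ w, 0 ≤ 1 + p w) (hq : ∀ w, 0 ≤ 1 + q w) {𝔞 : Ideal (𝓞 L)} (h𝔞 : 𝔞 ≠ ⊥)
    (hcop : IsCoprime 𝔞 (HeckeCharacter.modulusIdeal T e)) : IsIntegral ℤ (Psi χ 𝔞) := by
  refine induction_on_coprime (P := fun I => IsIntegral ℤ (Psi χ I)) (HeckeCharacter.modulusIdeal T e) ?_
    (fun v I hI hv _ ih => ?_) h𝔞 hcop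
  · simp only [Psi, Ideal.absNorm_top, Nat.cast_one, one_mul, idealPow_top]; exact isIntegral_one
  · rw [Psi_mul χ v.ne_bot hI, Psi_asIdeal]
    exact (isIntegral_residueCard_mul_valueAtUniformizer hinf hmod hp hq (not_mem_of_isCoprime hv)).mul ih

/-- **A uniform exponent**: there is `n ≥ 1` such that for every `v ∉ T`, `(N v · χ(ϖ_v))^n = B(b)` for some
`b ≠ 0`, `b ≡ 1 mod 𝔪` (`n = h k`, `h` a class-group exponent, `k = #(𝓞_L/𝔪)ˣ`). -/
theorem exists_uniform_pow_eq_embProd (hinf : χ.HasInfinityType p q) (hmod : HeckeCharacter.IsModulus χ T e)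
    (hp : ∀ w, 0 ≤ 1 + p w) (hq : ∀ w, 0 ≤ 1 + q w) :
    ∃ n : ℕ, 0 < n ∧ ∀ v : HeightOneSpectrum (𝓞 L), v ∉ T → ∃ b : 𝓞 L, b ≠ 0 ∧
      b - 1 ∈ HeckeCharacter.modulusIdeal T e ∧
      ((v.residueCard : ℂ) * χ.valueAtUniformizer v) ^ n =
        embProd (fun w => (1 + p w).toNat) (fun w => (1 + q w).toNat) (b : L) := by
  set 𝔪 := HeckeCharacter.modulusIdeal T e with h𝔪def
  have h𝔪 : 𝔪 ≠ ⊥ := HeckeCharacter.modulusIdeal_ne_bot T e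
  obtain ⟨h, hh, hgen⟩ := exists_forall_span_singleton_eq_pow L
  haveI : Finite (𝓞 L ⧸ 𝔪) := Ideal.finiteQuotientOfFreeOfNeBot 𝔪 h𝔪
  set k := Nat.card (𝓞 L ⧸ 𝔪)ˣ with hk
  have hkpos : 0 < k := Nat.card_pos
  refine ⟨h * k, Nat.mul_pos hh hkpos, fun v hv => ?_⟩
  obtain ⟨g, hg⟩ := hgen v
  have hg0 : g ≠ 0 := by
    intro h0
    rw [h0, Ideal.span_singleton_zero] at hg
    exact pow_ne_zero h v.ne_bot hg.symm
  have hcopv : IsCoprime (v.asIdeal ^ h) 𝔪 := (HeckeCharacter.isCoprime_asIdeal_modulusIdeal hv).pow_left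
  have hcopg : IsCoprime (Ideal.span {g}) 𝔪 := by rwa [hg]
  have hunit : IsUnit (Ideal.Quotient.mk 𝔪 g) := by
    obtain ⟨x, hx, y, hy, hxy⟩ := Ideal.isCoprime_iff_exists.mp hcopg
    obtain ⟨r, rfl⟩ := Ideal.mem_span_singleton'.mp hx
    refine IsUnit.of_mul_eq_one (Ideal.Quotient.mk 𝔪 r) ?_
    rw [← map_mul, ← map_one (Ideal.Quotient.mk 𝔪), Ideal.Quotient.eq]
    have : g * r - 1 = -y := by rw [← hxy]; ring
    rw [this]
    exact 𝔪.neg_mem hy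
  obtain ⟨u, hu⟩ := hunit
  have hgk : g ^ k - 1 ∈ 𝔪 := by
    rw [← Ideal.Quotient.eq, map_pow, ← hu, ← Units.val_pow_eq_pow_val, pow_card_eq_one', Units.val_one, map_one]
  refine ⟨g ^ k, pow_ne_zero _ hg0, hgk, ?_⟩
  rw [← Psi_asIdeal, ← Psi_pow χ v.ne_bot, pow_mul, ← hg, Ideal.span_singleton_pow,
    Psi_span_eq_embProd hinf hmod hp hq (pow_ne_zero _ hg0) hgk, RingOfIntegers.coe_eq_algebraMap, map_pow,
    ← RingOfIntegers.coe_eq_algebraMap]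

variable {𝔐 : Ideal (integralClosure ℤ ℂ)} [h𝔐 : 𝔐.IsMaximal] {ℓ : ℕ}

/-- **The prime values are torsion of order prime to `ℓ` modulo `𝔐`**: there is `N₀ ≥ 1`, `ℓ ∤ N₀`, with
`(N v · χ(ϖ_v) mod 𝔐)^{N₀} = 1` for all `v ∉ T`, provided `𝔪 ⊆ (ℓ)` and `𝔐 ∋ ℓ`. -/
theorem exists_torsion_exponent (hinf : χ.HasInfinityType p q) (hmod : HeckeCharacter.IsModulus χ T e)
    (hp : ∀ w, 0 ≤ 1 + p w) (hq : ∀ w, 0 ≤ 1 + q w) (hℓ : ℓ.Prime)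
    (hT : HeckeCharacter.modulusIdeal T e ≤ Ideal.span {(ℓ : 𝓞 L)}) (hℓ𝔐 : (ℓ : integralClosure ℤ ℂ) ∈ 𝔐) :
    ∃ N₀ : ℕ, 0 < N₀ ∧ ¬ ℓ ∣ N₀ ∧ ∀ v : HeightOneSpectrum (𝓞 L), v ∉ T →
      Ideal.Quotient.mk 𝔐 (zlift ((v.residueCard : ℂ) * χ.valueAtUniformizer v)) ^ N₀ = 1 := by
  obtain ⟨n, hn, hall⟩ := exists_uniform_pow_eq_embProd hinf hmod hp hq
  obtain ⟨k, N₀, hN₀, hnk⟩ := Nat.exists_eq_pow_mul_and_not_dvd hn.ne' ℓ hℓ.one_lt.ne'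
  have hN₀pos : 0 < N₀ := Nat.pos_of_ne_zero fun h0 => by rw [h0, mul_zero] at hnk; exact hn.ne' hnk
  refine ⟨N₀, hN₀pos, hN₀, fun v hv => ?_⟩
  obtain ⟨b, hb, hb1, heq⟩ := hall v hv
  have hint := isIntegral_residueCard_mul_valueAtUniformizer hinf hmod hp hq hv
  apply pow_eq_one_of_pow_prime_pow_mul hℓ hℓ𝔐 (k := k)
  rw [← hnk, ← map_pow, ← zlift_pow hint, heq,
    mk_zlift_embProd_eq hℓ𝔐 _ _ (show b - 1 ∈ Ideal.span {(ℓ : 𝓞 L)} from hT hb1),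
    RingOfIntegers.coe_eq_algebraMap, map_one, embProd_one, zlift_one, map_one]

omit h𝔐 in
/-- **Torsion of `Ψ(𝔞) mod 𝔐`** for every `𝔞` prime to `𝔪`. -/
theorem mk_zlift_Psi_pow_eq_one (hinf : χ.HasInfinityType p q) (hmod : HeckeCharacter.IsModulus χ T e)
    (hp : ∀ w, 0 ≤ 1 + p w) (hq : ∀ w, 0 ≤ 1 + q w) {N₀ : ℕ}
    (hN : ∀ v : HeightOneSpectrum (𝓞 L), v ∉ T →
      Ideal.Quotient.mk 𝔐 (zlift ((v.residueCard : ℂ) * χ.valueAtUniformizer v)) ^ N₀ = 1)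
    {𝔞 : Ideal (𝓞 L)} (h𝔞 : 𝔞 ≠ ⊥) (hcop : IsCoprime 𝔞 (HeckeCharacter.modulusIdeal T e)) :
    Ideal.Quotient.mk 𝔐 (zlift (Psi χ 𝔞)) ^ N₀ = 1 := by
  refine induction_on_coprime (P := fun I => IsCoprime I (HeckeCharacter.modulusIdeal T e) →
      Ideal.Quotient.mk 𝔐 (zlift (Psi χ I)) ^ N₀ = 1) (HeckeCharacter.modulusIdeal T e) ?_
    (fun v I hI hv hIc ih => fun _ => ?_) h𝔞 hcop hcop
  · intro _
    simp only [Psi, Ideal.absNorm_top, Nat.cast_one, one_mul, idealPow_top, zlift_one, map_one, one_pow]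
  · rw [Psi_mul χ v.ne_bot hI, Psi_asIdeal,
      zlift_mul (isIntegral_residueCard_mul_valueAtUniformizer hinf hmod hp hq (not_mem_of_isCoprime hv))
        (isIntegral_Psi hinf hmod hp hq hI hIc),
      map_mul, mul_pow, hN v (not_mem_of_isCoprime hv), ih hIc, one_mul]

/-- **`Ψ((b)) ≡ Ψ((c)) (mod 𝔐)` on the ray modulo `𝔪`** (`c` prime to `𝔪 ⊆ (ℓ)`, `b ≡ c mod 𝔪`). -/
theorem mk_zlift_Psi_span_eq (hinf : χ.HasInfinityType p q) (hmod : HeckeCharacter.IsModulus χ T e)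
    (hp : ∀ w, 0 ≤ 1 + p w) (hq : ∀ w, 0 ≤ 1 + q w)
    (hT : HeckeCharacter.modulusIdeal T e ≤ Ideal.span {(ℓ : 𝓞 L)}) (hℓ𝔐 : (ℓ : integralClosure ℤ ℂ) ∈ 𝔐)
    {b c : 𝓞 L} (hb : b ≠ 0) (hc : c ≠ 0) (hcop : IsCoprime (Ideal.span {c}) (HeckeCharacter.modulusIdeal T e))
    (hbc : b - c ∈ HeckeCharacter.modulusIdeal T e) :
    Ideal.Quotient.mk 𝔐 (zlift (Psi χ (Ideal.span {b}))) = Ideal.Quotient.mk 𝔐 (zlift (Psi χ (Ideal.span {c}))) := by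
  haveI := h𝔐.isPrime
  haveI : IsDomain (integralClosure ℤ ℂ ⧸ 𝔐) := Ideal.Quotient.isDomain 𝔐
  set a₁ : InfinitePlace L → ℕ := fun w => (1 + p w).toNat
  set b₁ : InfinitePlace L → ℕ := fun w => (1 + q w).toNat
  have key := Psi_span_mul_embProd_eq hinf hmod hp hq hb hc hcop hbc
  have hbcop : IsCoprime (Ideal.span {b}) (HeckeCharacter.modulusIdeal T e) := isCoprime_span_of_sub_mem hcop hbc
  have hb0 : Ideal.span {b} ≠ ⊥ := by rwa [Ne, Ideal.span_singleton_eq_bot]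
  have hc0 : Ideal.span {c} ≠ ⊥ := by rwa [Ne, Ideal.span_singleton_eq_bot]
  have hΨb := isIntegral_Psi hinf hmod hp hq hb0 hbcop
  have hΨc := isIntegral_Psi hinf hmod hp hq hc0 hcop
  -- the identity in `ℤ̄`, then modulo `𝔐`
  have key' : zlift (Psi χ (Ideal.span {b})) * zlift (embProd a₁ b₁ (c : L)) =
      zlift (Psi χ (Ideal.span {c})) * zlift (embProd a₁ b₁ (b : L)) := by
    rw [← zlift_mul hΨb (isIntegral_embProd _ _ c), ← zlift_mul hΨc (isIntegral_embProd _ _ b), key]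
  have hcℓ : IsCoprime (Ideal.span {c}) (Ideal.span {(ℓ : 𝓞 L)}) := by
    rw [Ideal.isCoprime_iff_sup_eq] at hcop ⊢
    exact eq_top_iff.mpr (hcop.ge.trans (sup_le_sup_left hT _))
  have hBc : Ideal.Quotient.mk 𝔐 (zlift (embProd a₁ b₁ (c : L))) ≠ 0 := mk_zlift_embProd_ne_zero hℓ𝔐 a₁ b₁ hcℓ
  have hBeq : Ideal.Quotient.mk 𝔐 (zlift (embProd a₁ b₁ (b : L))) = Ideal.Quotient.mk 𝔐 (zlift (embProd a₁ b₁ (c : L))) :=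
    mk_zlift_embProd_eq hℓ𝔐 a₁ b₁ (hT hbc)
  have h := congrArg (Ideal.Quotient.mk 𝔐) key'
  rw [map_mul, map_mul, hBeq] at h
  exact mul_right_cancel₀ hBc h

end Reduction

/-! ### The Teichmüller twist -/

section Twist

variable {L : Type*} [Field L] [NumberField L] [IsTotallyComplex L] {χ : HeckeCharacter L}
  {p q : InfinitePlace L → ℤ} {T : Finset (HeightOneSpectrum (𝓞 L))} {e : HeightOneSpectrum (𝓞 L) → ℕ}
  {𝔐 : Ideal (integralClosure ℤ ℂ)} [h𝔐 : 𝔐.IsMaximal] {ℓ : ℕ}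

/-- **The Teichmüller twist.**  For `χ` of infinity type `(p, q)` with `1 + p_w, 1 + q_w ≥ 0` on a totally
complex field, a module of definition `(T, e)` with `𝔪(T, e) ⊆ (ℓ)` and a maximal ideal `𝔐 ∋ ℓ` of `ℤ̄`,
there is a Hecke character `χ₀` of finite order, unramified off `T`, such that for every `v ∉ T` the number
`N v · χ(ϖ_v) · χ₀(ϖ_v)` is an algebraic integer congruent to `1` modulo `𝔐`. -/
theorem exists_teichmuller_twist (hinf : χ.HasInfinityType p q) (hmod : HeckeCharacter.IsModulus χ T e)
    (hp : ∀ w, 0 ≤ 1 + p w) (hq : ∀ w, 0 ≤ 1 + q w) (hℓ : ℓ.Prime)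
    (hT : HeckeCharacter.modulusIdeal T e ≤ Ideal.span {(ℓ : 𝓞 L)}) (hℓ𝔐 : (ℓ : integralClosure ℤ ℂ) ∈ 𝔐) :
    ∃ χ₀ : HeckeCharacter L, χ₀.IsFiniteOrder ∧ ∀ v : HeightOneSpectrum (𝓞 L), v ∉ T →
      χ₀.IsUnramifiedAt v ∧ ∃ z : integralClosure ℤ ℂ,
        algebraMap (integralClosure ℤ ℂ) ℂ z =
          (v.residueCard : ℂ) * χ.valueAtUniformizer v * χ₀.valueAtUniformizer v ∧
        Ideal.Quotient.mk 𝔐 z = 1 := by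
  haveI := h𝔐.isPrime
  haveI : IsDomain (integralClosure ℤ ℂ ⧸ 𝔐) := Ideal.Quotient.isDomain 𝔐
  set 𝔪 := HeckeCharacter.modulusIdeal T e with h𝔪def
  have h𝔪 : 𝔪 ≠ ⊥ := HeckeCharacter.modulusIdeal_ne_bot T e
  -- the torsion exponent and the Teichmüller lift
  obtain ⟨N₀, hN₀pos, hN₀, htor⟩ := exists_torsion_exponent hinf hmod hp hq hℓ hT hℓ𝔐
  obtain ⟨τ, hτ⟩ := exists_teichmuller (𝔐 := 𝔐) hℓ hℓ𝔐 hN₀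
  -- reduction of `Ψ`
  set red : Ideal (𝓞 L) → integralClosure ℤ ℂ ⧸ 𝔐 := fun 𝔞 => Ideal.Quotient.mk 𝔐 (zlift (Psi χ 𝔞)) with hred
  have hredtor : ∀ 𝔞 : Ideal (𝓞 L), 𝔞 ≠ ⊥ → IsCoprime 𝔞 𝔪 → red 𝔞 ^ N₀ = 1 := fun 𝔞 h𝔞 hcop =>
    mk_zlift_Psi_pow_eq_one hinf hmod hp hq htor h𝔞 hcop
  have hredmul : ∀ (v : HeightOneSpectrum (𝓞 L)) (𝔞 : Ideal (𝓞 L)), 𝔞 ≠ ⊥ → IsCoprime v.asIdeal 𝔪 → IsCoprime 𝔞 𝔪 →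
      red (v.asIdeal * 𝔞) = red v.asIdeal * red 𝔞 := fun v 𝔞 h𝔞 hv hcop => by
    simp only [hred]
    rw [Psi_mul χ v.ne_bot h𝔞, zlift_mul (isIntegral_Psi hinf hmod hp hq v.ne_bot hv) (isIntegral_Psi hinf hmod hp hq h𝔞 hcop),
      map_mul]
  -- the values on primes
  set lam : HeightOneSpectrum (𝓞 L) → ℂ := fun v => (τ (red v.asIdeal))⁻¹ with hlam
  have hlampow : ∀ 𝔞 : Ideal (𝓞 L), 𝔞 ≠ ⊥ → IsCoprime 𝔞 𝔪 → idealPow L lam 𝔞 = (τ (red 𝔞))⁻¹ := by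
    intro 𝔞 h𝔞 hcop
    refine induction_on_coprime (P := fun I => IsCoprime I 𝔪 → idealPow L lam I = (τ (red I))⁻¹) 𝔪 ?_
      (fun v I hI hv hIc ih => fun _ => ?_) h𝔞 hcop hcop
    · intro _
      have h1 : red ⊤ = 1 := by
        simp only [hred, Psi, Ideal.absNorm_top, Nat.cast_one, one_mul, idealPow_top, zlift_one, map_one]
      rw [idealPow_top, h1, teichmuller_one hℓ hℓ𝔐 hN₀ hτ, inv_one]
    · rw [idealPow_mul _ v.ne_bot hI, idealPow_asIdeal, ih hIc, hredmul v I hI hv hIc,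
        teichmuller_mul hℓ hℓ𝔐 hN₀ hτ (hredtor _ v.ne_bot hv) (hredtor _ hI hIc), mul_inv]
  -- `lam` is a ray class character modulo `𝔪`
  have hray : IsRayClassCharacter 𝔪 lam := by
    refine ⟨fun v hv => ?_, fun b c hb hc hcop hbc _ => ?_⟩
    · have hv' : v ∉ T := fun h => hv (HeckeCharacter.modulusIdeal_le_iff.mpr h)
      have hcopv : IsCoprime v.asIdeal 𝔪 := HeckeCharacter.isCoprime_asIdeal_modulusIdeal hv'
      simp only [hlam]
      rw [norm_inv, norm_teichmuller hN₀pos (hτ _ (hredtor _ v.ne_bot hcopv)).1, inv_one]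
    · have hbcop : IsCoprime (Ideal.span {b}) 𝔪 := isCoprime_span_of_sub_mem hcop hbc
      have hb0 : Ideal.span {b} ≠ ⊥ := by rwa [Ne, Ideal.span_singleton_eq_bot]
      have hc0 : Ideal.span {c} ≠ ⊥ := by rwa [Ne, Ideal.span_singleton_eq_bot]
      rw [hlampow _ hb0 hbcop, hlampow _ hc0 hcop]
      simp only [hred]
      rw [mk_zlift_Psi_span_eq hinf hmod hp hq hT hℓ𝔐 hb hc hcop hbc]
  -- the Hecke character of `lam`
  obtain ⟨χ₀, hfin, hχ₀⟩ := HeckeCharacter.exists_of_isRayClassCharacter h𝔪 hray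
  refine ⟨χ₀, hfin, fun v hv => ?_⟩
  have hv' : ¬ 𝔪 ≤ v.asIdeal := fun h => hv (HeckeCharacter.modulusIdeal_le_iff.mp h)
  obtain ⟨hunr, hval⟩ := hχ₀ v hv'
  refine ⟨hunr, ?_⟩
  have hcopv : IsCoprime v.asIdeal 𝔪 := HeckeCharacter.isCoprime_asIdeal_modulusIdeal hv
  have hx : red v.asIdeal ^ N₀ = 1 := hredtor _ v.ne_bot hcopv
  have hint := isIntegral_residueCard_mul_valueAtUniformizer hinf hmod hp hq hv
  have hτx := hτ _ hx
  have hτi : IsIntegral ℤ (τ (red v.asIdeal)) := IsIntegral.of_pow hN₀pos (by rw [hτx.1]; exact isIntegral_one)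
  -- `(τ x)⁻¹ = (τ x)^{N₀ - 1}`
  have hinv : (τ (red v.asIdeal))⁻¹ = τ (red v.asIdeal) ^ (N₀ - 1) :=
    inv_eq_of_mul_eq_one_right (by rw [← pow_succ', Nat.sub_add_cancel hN₀pos, hτx.1])
  refine ⟨zlift ((v.residueCard : ℂ) * χ.valueAtUniformizer v) * zlift (τ (red v.asIdeal)) ^ (N₀ - 1), ?_, ?_⟩
  · rw [map_mul, map_pow, algebraMap_zlift hint, algebraMap_zlift hτi, hval, hlam]
    simp only []
    rw [hinv]
  · have hredv : red v.asIdeal = Ideal.Quotient.mk 𝔐 (zlift ((v.residueCard : ℂ) * χ.valueAtUniformizer v)) := by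
      simp only [hred]; rw [Psi_asIdeal]
    rw [map_mul, map_pow, hτx.2, ← hredv, ← pow_succ', Nat.sub_add_cancel hN₀pos, hx]

omit [IsTotallyComplex L] h𝔐 in
/-- **A module of definition divisible by `ℓ`**: every Hecke character admits a module of definition
`(T, e)` with `𝔪(T, e) ⊆ (ℓ)` (enlarge any module of definition by the primes of `ℓ` with big exponents). -/
theorem exists_isModulus_le_span (χ : HeckeCharacter L) {ℓ : ℕ} (hℓ : ℓ ≠ 0) :
    ∃ (T : Finset (HeightOneSpectrum (𝓞 L))) (e : HeightOneSpectrum (𝓞 L) → ℕ),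
      HeckeCharacter.IsModulus χ T e ∧ HeckeCharacter.modulusIdeal T e ≤ Ideal.span {(ℓ : 𝓞 L)} := by
  obtain ⟨T₀, e₀, hmod₀⟩ := HeckeCharacter.exists_isModulus χ
  set 𝔩 : Ideal (𝓞 L) := Ideal.span {(ℓ : 𝓞 L)} with h𝔩def
  have h𝔩 : 𝔩 ≠ ⊥ := by
    rw [h𝔩def, Ne, Ideal.span_singleton_eq_bot]; exact_mod_cast hℓ
  set S : Finset (HeightOneSpectrum (𝓞 L)) := (Ideal.finite_factors h𝔩).toFinset with hS
  refine ⟨T₀ ∪ S, fun v => e₀ v + modulusExp 𝔩 v, fun x hx1 hxu hxc => hmod₀ x hx1 hxu fun v hv => ?_, ?_⟩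
  · refine (hxc v (Finset.mem_union_left _ hv)).trans ?_
    exact WithZero.exp_le_exp.mpr (by push_cast; omega)
  · intro r hr
    refine mem_of_forall_mem_pow_modulusExp h𝔩 fun v hv => ?_
    have hvS : v ∈ T₀ ∪ S := by
      refine Finset.mem_union_right _ ?_
      rw [hS, Set.Finite.mem_toFinset, Set.mem_setOf_eq]
      exact Ideal.dvd_iff_le.mpr ((modulusExp_ne_zero_iff 𝔩 h𝔩 v).mp hv)
    have h1 : HeckeCharacter.modulusIdeal (T₀ ∪ S) (fun v => e₀ v + modulusExp 𝔩 v) ≤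
        v.asIdeal ^ (e₀ v + modulusExp 𝔩 v + 1) := by
      rw [HeckeCharacter.modulusIdeal]
      exact (Ideal.prod_le_inf.trans (Finset.inf_le hvS))
    exact Ideal.pow_le_pow_right (by omega) (h1 hr)

end Twist

end Summit.Langlands.Langlands.Theorems.ResidualAutomorphyEven
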